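import Literature.Analysis.Calculus.HadamardLemma
import Mathlib.Analysis.SpecialFunctions.SmoothTransition
import Mathlib.Analysis.SpecialFunctions.Integrals.Basic
import Mathlib.Analysis.Calculus.MeanValue
import Mathlib.MeasureTheory.Integral.IntervalIntegral.FundThmCalculus

/-!
# The nested-Hill radial profile (1-D part of the S⁺ witness against `SliceHeredityAtOne`)

Cell `ns-blowup`, seat `ns-blowup-refuter4` (g5), NEGATIVE lane of item 19249 `HeredityAtOne`
(`--supports`; nothing here asserts a route statement). The strategy census
(`Cruxes/HeredityAtOne/StrategyCensus.lean`, §2(e)) files the design-free strengthening S⁺ =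
`SliceHeredityAtOne` as the vacuity-free refutation target and gives the template
`not_sliceHeredityAtOne_of_lazy_envelope_slice`: ONE envelope slice with a lazy tame unforced run. The
witness is a NESTED HILL VORTEX: vorticity `ω = η(|x|) (−x₁, x₀, 0)` with a smooth radial plateau
`η = A φ(|x|²)`, `φ = 1` on the core ball `|x|² ≤ q₁`, `φ = 0` off `|x|² ≥ q₂`, `0 ≤ φ ≤ 1`; its velocity is
`v(x) = (2 G(q) − q H(q)) e₂ + H(q) x₂ x`, `q = |x|²`, with two radial profiles; THIS file carries the
vorticity-moment profile

* `H q = A ∫₀¹ u⁴ φ(u² q) du` (`= |x|⁻⁵ ∫₀^{|x|} s⁴ η`, the normalised vorticity moment; `H_sq_eq`),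

smooth (a parametric integral over `[0, 1]`, `Calculus.contDiff_intervalIntegral`), with the identity
`2 q H′(q) = A φ(q) − 5 H(q)` (`two_mul_deriv_H`, the one carrying `curl v = ω` in the field file), the core
plateau `H = A/5` (`q ≤ q₁`), the exterior closed form `H(r²) = A K(√q₂)/r⁵` (`K(r) = ∫₀^r s⁴ φ(s²) ds`)
and the bounds `0 ≤ H ≤ A/5`; the stream profile `G` (`G′ = −H/2`, dipole matching) is in
`NestedHillStreamProfile.lean`. No improper integrals, no real powers.

LABEL: kernel calculus; no named fact; nothing about Navier–Stokes. [folklore] (Hill 1894; Acheson,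
Elementary Fluid Dynamics §5.5, cf. `Literature/Analysis/FluidPDE/HillSphericalVortex.lean`; the smooth
nesting is the standard mollified-plateau variant.)
-/

noncomputable section

namespace Summit.NavierStokesRegularity.HeredityAtOneNestedHill

open Set MeasureTheory intervalIntegral Filter Topology

/-- Parameters of a nested Hill profile: amplitude `A > 0` and the squared radii `0 < q₁ < q₂` of the
plateau core and of the vortical ball. [folklore] -/
structure HillData where
  /-- plateau height of `η = ω_θ / r` -/
  A : ℝ
  /-- squared core radius (`φ = 1` on `q ≤ q₁`) -/
  q₁ : ℝ
  /-- squared outer radius (`φ = 0` on `q₂ ≤ q`) -/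
  q₂ : ℝ
  A_pos : 0 < A
  q₁_pos : 0 < q₁
  q₁_lt_q₂ : q₁ < q₂

namespace HillData

variable (P : HillData)

/-- `0 < q₂`. [folklore] -/
theorem q₂_pos : 0 < P.q₂ := P.q₁_pos.trans P.q₁_lt_q₂

/-- `0 < q₂ − q₁`. [folklore] -/
theorem sub_pos : 0 < P.q₂ - P.q₁ := _root_.sub_pos.2 P.q₁_lt_q₂

/-! ## §1 The plateau cutoff `φ` -/

/-- The plateau cutoff `φ(q) = smoothTransition ((q₂ − q)/(q₂ − q₁))`. [folklore] -/
def cutoff (q : ℝ) : ℝ := Real.smoothTransition ((P.q₂ - q) / (P.q₂ - P.q₁))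

/-- `φ` is smooth. [folklore] -/
theorem cutoff_contDiff {n : ℕ∞} : ContDiff ℝ n P.cutoff :=
  Real.smoothTransition.contDiff.comp ((contDiff_const.sub contDiff_id).div_const _)

/-- `φ` is continuous. [folklore] -/
theorem cutoff_continuous : Continuous P.cutoff := (P.cutoff_contDiff (n := 0)).continuous

/-- `0 ≤ φ`. [folklore] -/
theorem cutoff_nonneg (q : ℝ) : 0 ≤ P.cutoff q := Real.smoothTransition.nonneg _

/-- `φ ≤ 1`. [folklore] -/
theorem cutoff_le_one (q : ℝ) : P.cutoff q ≤ 1 := Real.smoothTransition.le_one _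

/-- `φ = 1` on the core `q ≤ q₁`. [folklore] -/
theorem cutoff_eq_one {q : ℝ} (hq : q ≤ P.q₁) : P.cutoff q = 1 :=
  Real.smoothTransition.one_of_one_le ((one_le_div P.sub_pos).2 (by linarith))

/-- `φ = 0` off the vortical ball, `q₂ ≤ q`. [folklore] -/
theorem cutoff_eq_zero {q : ℝ} (hq : P.q₂ ≤ q) : P.cutoff q = 0 :=
  Real.smoothTransition.zero_of_nonpos (div_nonpos_iff.2 (Or.inr ⟨by linarith, P.sub_pos.le⟩))

/-! ## §2 The vorticity-moment profile `H` -/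

/-- `H(q) = A ∫₀¹ u⁴ φ(u² q) du`. [folklore] -/
def H (q : ℝ) : ℝ := P.A * ∫ u in (0 : ℝ)..1, u ^ 4 * P.cutoff (u ^ 2 * q)

/-- `H` is smooth (smooth dependence of a parametric integral over `[0, 1]`). [folklore] -/
theorem H_contDiff {n : ℕ∞} : ContDiff ℝ n P.H := by
  unfold H
  refine contDiff_const.mul ?_
  have h : ContDiff ℝ n (Function.uncurry fun (q u : ℝ) => u ^ 4 * P.cutoff (u ^ 2 * q)) := by
    change ContDiff ℝ n (fun p : ℝ × ℝ => p.2 ^ 4 * P.cutoff (p.2 ^ 2 * p.1))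
    exact (contDiff_snd.pow 4).mul (P.cutoff_contDiff.comp ((contDiff_snd.pow 2).mul contDiff_fst))
  exact Literature.Analysis.Calculus.contDiff_intervalIntegral h 0 1

/-- `H` is continuous. [folklore] -/
theorem H_continuous : Continuous P.H := (P.H_contDiff (n := 0)).continuous

/-- `H` is differentiable. [folklore] -/
theorem H_differentiable : Differentiable ℝ P.H := (P.H_contDiff (n := 1)).differentiable (by simp)

/-- `H` has a derivative everywhere. [folklore] -/
theorem hasDerivAt_H (q : ℝ) : HasDerivAt P.H (deriv P.H q) q :=
  (P.H_differentiable q).hasDerivAt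

/-- the integrand of `H` is continuous in `u`. [folklore] -/
theorem H_integrand_continuous (q : ℝ) : Continuous fun u : ℝ => u ^ 4 * P.cutoff (u ^ 2 * q) :=
  (continuous_pow 4).mul (P.cutoff_continuous.comp ((continuous_pow 2).mul continuous_const))

/-- **Core plateau**: `H = A/5` on `q ≤ q₁` (there `φ(u² q) = 1` for `u ∈ [0, 1]`). [folklore] -/
theorem H_eq_core {q : ℝ} (hq : q ≤ P.q₁) : P.H q = P.A / 5 := by
  unfold H
  have h : EqOn (fun u : ℝ => u ^ 4 * P.cutoff (u ^ 2 * q)) (fun u => u ^ 4) (uIcc 0 1) := by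
    intro u hu
    rw [uIcc_of_le zero_le_one] at hu
    have hle : u ^ 2 * q ≤ P.q₁ := by
      rcases le_or_gt q 0 with hq0 | hq0
      · nlinarith [mul_nonneg (sq_nonneg u) (neg_nonneg.2 hq0), P.q₁_pos]
      · have hu1 : u ^ 2 ≤ 1 := by nlinarith [hu.1, hu.2]
        nlinarith
    show u ^ 4 * P.cutoff (u ^ 2 * q) = u ^ 4
    rw [P.cutoff_eq_one hle, mul_one]
  rw [integral_congr h, integral_pow]
  norm_num
  ring

/-- `0 ≤ H`. [folklore] -/
theorem H_nonneg (q : ℝ) : 0 ≤ P.H q := by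
  unfold H
  exact mul_nonneg P.A_pos.le
    (intervalIntegral.integral_nonneg zero_le_one fun u hu =>
      mul_nonneg (pow_nonneg hu.1 4) (P.cutoff_nonneg _))

/-- `H ≤ A/5` (`φ ≤ 1`). [folklore] -/
theorem H_le (q : ℝ) : P.H q ≤ P.A / 5 := by
  unfold H
  have h1 : (∫ u in (0 : ℝ)..1, u ^ 4 * P.cutoff (u ^ 2 * q)) ≤ ∫ u in (0 : ℝ)..1, u ^ 4 := by
    refine intervalIntegral.integral_mono_on zero_le_one
      ((P.H_integrand_continuous q).intervalIntegrable _ _)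
      ((continuous_pow 4).intervalIntegrable _ _) fun u hu => ?_
    calc u ^ 4 * P.cutoff (u ^ 2 * q) ≤ u ^ 4 * 1 :=
          mul_le_mul_of_nonneg_left (P.cutoff_le_one _) (pow_nonneg hu.1 4)
      _ = u ^ 4 := mul_one _
  rw [integral_pow] at h1
  norm_num at h1
  have := mul_le_mul_of_nonneg_left h1 P.A_pos.le
  linarith

/-! ## §3 The radial primitive `K` and the identity `2 q H′ = A φ − 5 H` -/

/-- `K(r) = ∫₀^r s⁴ φ(s²) ds` (so that `H(r²) = A K(r)/r⁵`, `H_sq_eq`). [folklore] -/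
def K (r : ℝ) : ℝ := ∫ s in (0 : ℝ)..r, s ^ 4 * P.cutoff (s ^ 2)

/-- the integrand of `K` is continuous. [folklore] -/
theorem K_integrand_continuous : Continuous fun s : ℝ => s ^ 4 * P.cutoff (s ^ 2) :=
  (continuous_pow 4).mul (P.cutoff_continuous.comp (continuous_pow 2))

/-- `K′(r) = r⁴ φ(r²)`. [folklore] -/
theorem hasDerivAt_K (r : ℝ) : HasDerivAt P.K (r ^ 4 * P.cutoff (r ^ 2)) r :=
  (P.K_integrand_continuous.integral_hasStrictDerivAt 0 r).hasDerivAt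

/-- **Substitution**: `H(r²) = A K(r)/r⁵` for `r ≠ 0`. [folklore] -/
theorem H_sq_eq {r : ℝ} (hr : r ≠ 0) : P.H (r ^ 2) = P.A * P.K r / r ^ 5 := by
  unfold H K
  have h1 : (fun u : ℝ => u ^ 4 * P.cutoff (u ^ 2 * r ^ 2)) =
      fun u => (r ^ 4)⁻¹ * ((fun s : ℝ => s ^ 4 * P.cutoff (s ^ 2)) (r * u)) := by
    funext u
    have hr4 : r ^ 4 ≠ 0 := pow_ne_zero 4 hr
    simp only [mul_pow]
    field_simp
  rw [h1, intervalIntegral.integral_const_mul,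
    intervalIntegral.integral_comp_mul_left (fun s : ℝ => s ^ 4 * P.cutoff (s ^ 2)) hr,
    mul_zero, mul_one, smul_eq_mul]
  field_simp

/-- `K` is constant beyond the vortical ball: `K r = K √q₂` for `√q₂ ≤ r`. [folklore] -/
theorem K_eq_of_le {r : ℝ} (hr : Real.sqrt P.q₂ ≤ r) : P.K r = P.K (Real.sqrt P.q₂) := by
  unfold K
  rw [← integral_add_adjacent_intervals (b := Real.sqrt P.q₂)
    (P.K_integrand_continuous.intervalIntegrable _ _) (P.K_integrand_continuous.intervalIntegrable _ _)]
  have h0 : ∫ s in Real.sqrt P.q₂..r, s ^ 4 * P.cutoff (s ^ 2) = 0 := by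
    rw [← intervalIntegral.integral_zero (a := Real.sqrt P.q₂) (b := r)]
    refine integral_congr fun s hs => ?_
    rw [uIcc_of_le hr] at hs
    have hs2 : P.q₂ ≤ s ^ 2 := by
      have h1 : Real.sqrt P.q₂ ^ 2 = P.q₂ := Real.sq_sqrt P.q₂_pos.le
      have h2 : 0 ≤ Real.sqrt P.q₂ := Real.sqrt_nonneg _
      nlinarith [hs.1]
    show s ^ 4 * P.cutoff (s ^ 2) = 0
    rw [P.cutoff_eq_zero hs2, mul_zero]
  rw [h0, add_zero]

/-- **Exterior closed form**: `H(r²) = A K(√q₂)/r⁵` for `√q₂ ≤ r` (the dipole strength `A K(√q₂)`).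
[folklore] -/
theorem H_sq_eq_exterior {r : ℝ} (hr : Real.sqrt P.q₂ ≤ r) :
    P.H (r ^ 2) = P.A * P.K (Real.sqrt P.q₂) / r ^ 5 := by
  have hr0 : 0 < r := (Real.sqrt_pos.2 P.q₂_pos).trans_le hr
  rw [P.H_sq_eq hr0.ne', P.K_eq_of_le hr]

/-- `0 < K(√q₂)` (the core contributes `∫₀^{√q₁} s⁴ ds > 0`). [folklore] -/
theorem K_sqrt_q₂_pos : 0 < P.K (Real.sqrt P.q₂) := by
  have h1 : 0 < Real.sqrt P.q₁ := Real.sqrt_pos.2 P.q₁_pos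
  have h12 : Real.sqrt P.q₁ ≤ Real.sqrt P.q₂ := Real.sqrt_le_sqrt P.q₁_lt_q₂.le
  unfold K
  rw [← integral_add_adjacent_intervals (b := Real.sqrt P.q₁)
    (P.K_integrand_continuous.intervalIntegrable _ _) (P.K_integrand_continuous.intervalIntegrable _ _)]
  have hcore : ∫ s in (0 : ℝ)..Real.sqrt P.q₁, s ^ 4 * P.cutoff (s ^ 2) = Real.sqrt P.q₁ ^ 5 / 5 := by
    have : ∫ s in (0 : ℝ)..Real.sqrt P.q₁, s ^ 4 * P.cutoff (s ^ 2) = ∫ s in (0 : ℝ)..Real.sqrt P.q₁, s ^ 4 := by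
      refine integral_congr fun s hs => ?_
      rw [uIcc_of_le h1.le] at hs
      have hs2 : s ^ 2 ≤ P.q₁ := by
        have := Real.sq_sqrt P.q₁_pos.le
        nlinarith [hs.1, hs.2]
      show s ^ 4 * P.cutoff (s ^ 2) = s ^ 4
      rw [P.cutoff_eq_one hs2, mul_one]
    rw [this, integral_pow]
    ring
  have hrest : 0 ≤ ∫ s in Real.sqrt P.q₁..Real.sqrt P.q₂, s ^ 4 * P.cutoff (s ^ 2) :=
    intervalIntegral.integral_nonneg h12 fun s hs =>
      mul_nonneg (pow_nonneg (h1.le.trans hs.1) 4) (P.cutoff_nonneg _)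
  rw [hcore]
  positivity

/-- **The moment identity `2 q H′(q) = A φ(q) − 5 H(q)`** (all `q`): on `q < q₁` both sides vanish
(`H` is locally the constant `A/5`, `φ = 1`); for `q = r² > 0` differentiate `H(r²) = A K(r)/r⁵`.
[folklore] -/
theorem two_mul_deriv_H (q : ℝ) : 2 * q * deriv P.H q = P.A * P.cutoff q - 5 * P.H q := by
  rcases lt_or_ge q P.q₁ with hq | hq
  · -- locally constant
    have hev : P.H =ᶠ[𝓝 q] fun _ => P.A / 5 := by
      filter_upwards [Iio_mem_nhds hq] with s hs using P.H_eq_core (le_of_lt hs)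
    rw [hev.deriv_eq, deriv_const, P.cutoff_eq_one hq.le, P.H_eq_core hq.le]
    ring
  · -- `q = r²`, `r > 0`
    have hq0 : 0 < q := P.q₁_pos.trans_le hq
    obtain ⟨r, hr0, hrq⟩ : ∃ r : ℝ, 0 < r ∧ r ^ 2 = q := ⟨Real.sqrt q, Real.sqrt_pos.2 hq0, Real.sq_sqrt hq0.le⟩
    subst hrq
    have hne : r ≠ 0 := hr0.ne'
    -- chain rule for `s ↦ H (s²)`
    have h1 : HasDerivAt (fun s : ℝ => P.H (s ^ 2)) (deriv P.H (r ^ 2) * (2 * r)) r := by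
      have hp : HasDerivAt (fun s : ℝ => s ^ 2) (2 * r) r := by
        simpa using hasDerivAt_pow 2 r
      have h := (P.hasDerivAt_H (r ^ 2)).comp r hp
      simpa [Function.comp_def] using h
    -- the closed form near `r`
    have h2 : HasDerivAt (fun s : ℝ => P.A * P.K s / s ^ 5)
        ((P.A * (r ^ 4 * P.cutoff (r ^ 2)) * r ^ 5 - P.A * P.K r * (5 * r ^ 4)) / (r ^ 5) ^ 2) r := by
      have hK := (P.hasDerivAt_K r).const_mul P.A
      have hp : HasDerivAt (fun s : ℝ => s ^ 5) (5 * r ^ 4) r := by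
        simpa using hasDerivAt_pow 5 r
      exact hK.div hp (pow_ne_zero 5 hne)
    have hev : (fun s : ℝ => P.H (s ^ 2)) =ᶠ[𝓝 r] fun s => P.A * P.K s / s ^ 5 := by
      filter_upwards [isOpen_ne.mem_nhds hne] with s hs using P.H_sq_eq hs
    have h3 := h2.congr_of_eventuallyEq hev
    have hD : deriv P.H (r ^ 2) * (2 * r) =
        (P.A * (r ^ 4 * P.cutoff (r ^ 2)) * r ^ 5 - P.A * P.K r * (5 * r ^ 4)) / (r ^ 5) ^ 2 :=
      h1.unique h3
    have hr5 : r ^ 5 ≠ 0 := pow_ne_zero 5 hne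
    have hr4 : r ^ 4 ≠ 0 := pow_ne_zero 4 hne
    have hr10 : (r ^ 5) ^ 2 ≠ 0 := pow_ne_zero 2 hr5
    rw [eq_div_iff hr10] at hD
    rw [P.H_sq_eq hne]
    apply mul_right_cancel₀ hr5
    rw [sub_mul, mul_assoc 5, div_mul_cancel₀ _ hr5]
    apply mul_right_cancel₀ hr4
    linear_combination hD

end HillData

end Summit.NavierStokesRegularity.HeredityAtOneNestedHill

end
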